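import Summits.QuantumFields.BalabanUV.Beta.GAN24.FaceWordCellPairingDeep
import Summits.QuantumFields.BalabanUV.Beta.GAN24.FaceWordEEValueDeep
import Summits.QuantumFields.BalabanUV.Beta.GAN24.EEWordReduced
import Summits.QuantumFields.BalabanUV.Beta.StepReflectionRec

/-!
# `BalabanUV.Beta.GAN24.FaceWordEEDeep` — binder row G-an2-4 ∕ (CONV-C), W-slot (α-0), ROW (C)sym AT LEVELS `≥ 1`, typer's PART VI row **T6-VAL**, the (γ) hand's
# letter **K7-a, ASSEMBLED FOR THE E SECTOR**: **leaf-02 Part 45's OUTPUT WORD FOR road-P2's UNIT-SCALED E-SECTOR TABLE `S^E = unitS sf sm (cE • V_j)` THROUGH `X̃♮_{j+1}`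
# AT THE DEEP PERIOD `Lc·N`, VALUED** —
# `Σ_{rr∈box(Lc·N)} Σ'_t χ(rr_μ)χ(t_ν)·Σ'_{(y,w)} χ(y_α)χ(w_β)·((S^E μ rr ∘ X̃♮_{j+1}) ∘ S^E ν t)(y,w)(inl α)(inl β)
#   = K_E²·(−½)(½)·sf²·( wVH_{j+1}⁻¹·⟨q^{(Lc·N)}_{μα}, E2_{j+1} q^{(Lc·N)}_{νβ}⟩_{box(Lc·N)} − wVH_{j+1}⁻¹·Lc^{d+1}·Lc^{d+1}·⟨q^{(N)}_{μα}, E2_{j+2} q^{(N)}_{νβ}⟩_{box N} )`,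
# `K_E = (sf·sm)⁻¹·sf⁻²·cE` (`μ ≠ α`, `ν ≠ β`; every `j`, `d`, in-block root, E's pins, any `cΛ`, all units, every `N ≥ 1`)
# — this seat's `FaceWordCellPairingDeep.faceWord_eq_cellPairing` ⨾ `FaceWordEEValueDeep.cellPairing_deep_value_units`, with the admissibility of `S^E` and `X̃♮` discharged
# from the tree (G-an2-4 CRUX TEAM (2), seat `b2b-balaban-gan24-formalise-leaf-06` = the (γ) hand, gen 56; journal [GAN24LEAF06-G56-INTENT3])

NOT IN PRINT; OUR BOOKKEEPING ([folklore] bookkeeping BY NAME: an2's `SpineRooted.locStencil_e3OfK ∕ e3OfK_translate ∕ e3OfK_inl_inr ∕ e3OfK_inr_inl ∕ e3OfK_inr_inr`,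
d1-leaf-10's `WardLocusRecursive.locStencil_SrecAt ∕ SrecAt_translate`, an2's `HessKerDressedUnits.locStencil_unitS ∕ decays_unitK ∕ unitS_apply`,
`AxialDressingRooted.decays_coDressKBmAt_KInvStep ∕ shiftK_coDressKBmAt_KInvStep`, leaf-04's `EEWordReduced.shiftK_dressedStep`, `StepJetData.locStencil_smul`,
`BalabanStepJets.locStencil_mono`, `OneStepResolventKernel.decays_mono`; 0 `def`, 0 cited fact, 0 `def … : Prop`, 0 sorry).
HONEST FRAMING (cell contract, verbatim): «discharging `BetaPertH` makes Bałaban's UV stability UNCONDITIONAL — a real constructive-QFT result; it is NOT the continuum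
limit and NOT the Clay problem.»  HONEST DEPENDENCY (verbatim): «continuum YM on T⁴ ⇐ BetaPertH ∧ nine spine estimates (0/9 proved); BetaPertH ⇐ (D1) ∧ (D4) ∧ CAP+tail;
G-an2-4 gates asym, D1 and NE2/3/4.»

WHAT ([folklore]): §1 admissibility of the pair `(S^E, X̃♮_{j+1})` at a common rate — `sectorE_inr_left ∕ sectorE_inr_right` (field legs only), `sectorE_translate` (fine covariance of
the slot), `exists_common_rate` (`LocStencil S^E Cs m ∧ Decays X̃♮ CX m`, `m > 0`), `dressedStep_invariant_deep` (`X̃♮` is `Lc·N`-invariant); §2 **`faceWordEE_deep_value`** (the display).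
Asserts NO value of Bałaban's tables beyond this identity; the E⊗VH ∕ VH⊗E ∕ VH⊗VH ∕ multiplier ∕ W face words, the swapped word, and the `LS`-assembly into road-P2's `FFsym` literal
are NOT here; discharges NOTHING of `hX` ∕ `hXu` ∕ (C)_{≥1} ∕ `hB0` ∕ `hBF` ∕ (Q-L) ∕ (hW, hWall); NEVER «G-an2-4 closed» as (CONV-C); NOT D1, NOT `BetaPertH`, NOT continuum, NOT Clay.
2026-08-24; no existing file touched.
-/

noncomputable section

open Finset
open scoped BigOperators
open Literature.MathematicalPhysics.QuantumFieldTheory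
open Literature.MathematicalPhysics.QuantumFieldTheory.Balaban1983to89
open Literature.MathematicalPhysics.QuantumFieldTheory.Balaban1983to89.Beta
open ExpKernelCalculus (Site MKer Decays BiLoc shiftK comp)
open OneStepResolventKernel (Fib LocStencil decays_mono)
open OneStepKernelFamily (KInvStep)
open BalabanStepJets (locStencil_mono)
open StepJetData (locStencil_smul)
open AffineAveraging (box toSite)
open BalabanStepJetsSucc (E2 wVH)
open Summit.QuantumFields.BalabanUV.Beta.AxialDressingRooted (coDressKBmAt one_le_of_neZero decays_coDressKBmAt_KInvStep shiftK_coDressKBmAt_KInvStep)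
open Summit.QuantumFields.BalabanUV.Beta.HessKerDressedUnits (unitK unitS unitS_apply locStencil_unitS decays_unitK)
open Summit.QuantumFields.BalabanUV.Beta.SpineRooted (e3OfK locStencil_e3OfK e3OfK_translate e3OfK_inl_inr e3OfK_inr_inl e3OfK_inr_inr)
open Summit.QuantumFields.BalabanUV.Beta.WardLocusRecursive (SrecAt locStencil_SrecAt SrecAt_translate)
open Summit.QuantumFields.BalabanUV.Beta.GAN24.EEWordReduced (shiftK_dressedStep)
open Summit.QuantumFields.BalabanUV.Beta.GAN24.FaceWordCellPairingDeep (faceWord_eq_cellPairing)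
open Summit.QuantumFields.BalabanUV.Beta.GAN24.FaceWordEEValueDeep (cellPairing_deep_value_units)

namespace Summit.QuantumFields.BalabanUV.Beta.GAN24.FaceWordEEDeep

variable {d : ℕ} {Lc : ℕ} [NeZero Lc] {r : Fin (d + 1) → ℕ}

/-! ## §1 Admissibility of road-P2's E-sector table and dressed step kernel at a common rate -/

/-- [folklore] **FIELD LEGS ONLY, FIRST LEG**: the unit-scaled E-sector table has no multiplier first leg (`e3OfK` is minus an `mmRead`). -/
theorem sectorE_inr_left (sf sm cE cΛ : ℝ) (j : ℕ) (κ : Fin (d + 1)) (t y x : Site (d + 1)) (m : Fin (d + 1)) (b : Fib d) :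
    unitS sf sm (fun κ u => cE • e3OfK Lc (coDressKBmAt (toSite r) Lc (KInvStep (d := d) Lc j))
        (SrecAt d Lc (toSite r) ((Lc : ℝ) ^ (d + 1)) (-((Lc : ℝ) ^ (d + 1) * (1 / 2) * (Lc : ℝ) ^ (d + 1))) cΛ j) κ u) κ t y x (Sum.inr m) b = 0 := by
  rw [unitS_apply]
  simp only [Pi.smul_apply, smul_eq_mul]
  cases b with
  | inl b => rw [e3OfK_inr_inl]; ring
  | inr b => rw [e3OfK_inr_inr]; ring

/-- [folklore] **FIELD LEGS ONLY, SECOND LEG**: the unit-scaled E-sector table has no multiplier second leg. -/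
theorem sectorE_inr_right (sf sm cE cΛ : ℝ) (j : ℕ) (κ : Fin (d + 1)) (t y x : Site (d + 1)) (a : Fib d) (m : Fin (d + 1)) :
    unitS sf sm (fun κ u => cE • e3OfK Lc (coDressKBmAt (toSite r) Lc (KInvStep (d := d) Lc j))
        (SrecAt d Lc (toSite r) ((Lc : ℝ) ^ (d + 1)) (-((Lc : ℝ) ^ (d + 1) * (1 / 2) * (Lc : ℝ) ^ (d + 1))) cΛ j) κ u) κ t y x a (Sum.inr m) = 0 := by
  rw [unitS_apply]
  simp only [Pi.smul_apply, smul_eq_mul]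
  cases a with
  | inl a => rw [e3OfK_inl_inr]; ring
  | inr a => rw [e3OfK_inr_inr]; ring

/-- [folklore] **FINE COVARIANCE OF THE SLOT** of the unit-scaled E-sector table (its slot is a coarse bond of the lower lattice: `e3OfK_translate` over `SrecAt_translate`,
through `unitS_apply`): `S^E κ (t + v) = shiftK (−v) (S^E κ t)` for EVERY `v`. -/
theorem sectorE_translate (sf sm cE cΛ : ℝ) (j : ℕ) (κ : Fin (d + 1)) (t v : Site (d + 1)) :
    unitS sf sm (fun κ u => cE • e3OfK Lc (coDressKBmAt (toSite r) Lc (KInvStep (d := d) Lc j))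
        (SrecAt d Lc (toSite r) ((Lc : ℝ) ^ (d + 1)) (-((Lc : ℝ) ^ (d + 1) * (1 / 2) * (Lc : ℝ) ^ (d + 1))) cΛ j) κ u) κ (t + v) =
      shiftK (-v) (unitS sf sm (fun κ u => cE • e3OfK Lc (coDressKBmAt (toSite r) Lc (KInvStep (d := d) Lc j))
        (SrecAt d Lc (toSite r) ((Lc : ℝ) ^ (d + 1)) (-((Lc : ℝ) ^ (d + 1) * (1 / 2) * (Lc : ℝ) ^ (d + 1))) cΛ j) κ u) κ t) := by
  have hLc : 1 ≤ Lc := one_le_of_neZero Lc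
  have h := e3OfK_translate (N := Lc) (shiftK_coDressKBmAt_KInvStep (d := d) (toSite r) j)
    (S := SrecAt d Lc (toSite r) ((Lc : ℝ) ^ (d + 1)) (-((Lc : ℝ) ^ (d + 1) * (1 / 2) * (Lc : ℝ) ^ (d + 1))) cΛ j)
    (SrecAt_translate (toSite r) hLc ((Lc : ℝ) ^ (d + 1)) (-((Lc : ℝ) ^ (d + 1) * (1 / 2) * (Lc : ℝ) ^ (d + 1))) cΛ j) κ t v
  funext x z a b
  simp only [unitS_apply, Pi.smul_apply, smul_eq_mul, shiftK, h]

/-- [folklore] **THE PAIR `(S^E, X̃♮_{j+1})` IS ADMISSIBLE AT A COMMON POSITIVE RATE**: `∃ Cs CX m, 0 < m ∧ LocStencil S^E Cs m ∧ Decays X̃♮_{j+1} CX m`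
(`locStencil_SrecAt` ⨾ `locStencil_e3OfK` ⨾ `locStencil_smul` ⨾ `locStencil_unitS`; `decays_coDressKBmAt_KInvStep` ⨾ `decays_unitK`; rates merged by monotonicity). -/
theorem exists_common_rate (hr : r ∈ box (d + 1) Lc) (sf sm cE cΛ : ℝ) (j : ℕ) :
    ∃ Cs CX m : ℝ, 0 < m ∧
      LocStencil (unitS sf sm (fun κ u => cE • e3OfK Lc (coDressKBmAt (toSite r) Lc (KInvStep (d := d) Lc j))
        (SrecAt d Lc (toSite r) ((Lc : ℝ) ^ (d + 1)) (-((Lc : ℝ) ^ (d + 1) * (1 / 2) * (Lc : ℝ) ^ (d + 1))) cΛ j) κ u)) Cs m ∧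
      Decays (unitK sf sm (coDressKBmAt (toSite r) Lc (KInvStep (d := d) Lc (j + 1)))) CX m := by
  have hLc : 1 ≤ Lc := one_le_of_neZero Lc
  obtain ⟨Cs₀, δs, hδs, hS₀⟩ := locStencil_SrecAt (d := d) hLc hr ((Lc : ℝ) ^ (d + 1)) (-((Lc : ℝ) ^ (d + 1) * (1 / 2) * (Lc : ℝ) ^ (d + 1))) cΛ j
  obtain ⟨C₁, δ₁, hδ₁, hV⟩ := locStencil_e3OfK (N := Lc) hLc (decays_coDressKBmAt_KInvStep (d := d) hr j) hS₀ hδs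
  have hVs := locStencil_unitS (sf := sf) (sm := sm) (locStencil_smul cE hV)
  obtain ⟨δK, CK, hδK, hCK, hXd⟩ := decays_coDressKBmAt_KInvStep (d := d) hr (j + 1)
  have hXu := decays_unitK (sf := sf) (sm := sm) hXd
  have hC1 : 0 ≤ |(sf * sm)⁻¹| * (max |sf⁻¹| |sm⁻¹| * (|cE| * C₁) * max |sf⁻¹| |sm⁻¹|) := by
    have : 0 ≤ C₁ := (hV 0 0).nonneg (Sum.inl 0)
    positivity
  have hC2 : 0 ≤ max |sf| |sm| * CK * max |sf| |sm| := by positivity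
  refine ⟨_, _, min δ₁ δK, lt_min hδ₁ hδK, locStencil_mono hVs hC1 (min_le_left _ _), decays_mono hXu hC2 le_rfl (min_le_right _ _)⟩

/-- [folklore] **`X̃♮_{j+1}` IS INVARIANT UNDER THE DEEP TRANSLATIONS `(Lc·N)•s`** (leaf-04's `shiftK_dressedStep` at `t = N•s`). -/
theorem dressedStep_invariant_deep (sf sm : ℝ) (j N : ℕ) (s : Site (d + 1)) :
    shiftK (-(((Lc * N : ℕ) : ℤ) • s)) (unitK sf sm (coDressKBmAt (toSite r) Lc (KInvStep (d := d) Lc (j + 1)))) =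
      unitK sf sm (coDressKBmAt (toSite r) Lc (KInvStep (d := d) Lc (j + 1))) := by
  have hLc : 1 ≤ Lc := one_le_of_neZero Lc
  have hs : (((Lc * N : ℕ) : ℤ) • s) = (Lc : ℤ) • ((N : ℤ) • s) := by
    rw [Nat.cast_mul, mul_smul]
  rw [hs]
  exact shiftK_dressedStep (r := r) hLc sf sm (j + 1) ((N : ℤ) • s)

/-! ## §2 The E⊗E face word of the level-`(j+1)` forcing at the deep period, valued from Part 45's output form -/

/-- NOT IN PRINT; OUR BOOKKEEPING.  **leaf-02 PART 45's OUTPUT WORD FOR THE E SECTOR AT PERIOD `Lc·N`, VALUED** (module docstring; `μ ≠ α`, `ν ≠ β`). -/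
theorem faceWordEE_deep_value (hr : r ∈ box (d + 1) Lc) (sf sm cE cΛ : ℝ) (j N : ℕ) [NeZero N] {μ α ν β : Fin (d + 1)} (hμα : μ ≠ α) (hνβ : ν ≠ β) :
    ∑ rr ∈ box (d + 1) (Lc * N), ∑' t : Site (d + 1),
        (if toSite rr μ % ((Lc * N : ℕ) : ℤ) = ((Lc * N : ℕ) : ℤ) - 1 then (1 : ℝ) else 0) * (if t ν % ((Lc * N : ℕ) : ℤ) = ((Lc * N : ℕ) : ℤ) - 1 then (1 : ℝ) else 0) *
        ∑' yw : Site (d + 1) × Site (d + 1),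
          (if yw.1 α % ((Lc * N : ℕ) : ℤ) = ((Lc * N : ℕ) : ℤ) - 1 then (1 : ℝ) else 0) * (if yw.2 β % ((Lc * N : ℕ) : ℤ) = ((Lc * N : ℕ) : ℤ) - 1 then (1 : ℝ) else 0) *
          comp (comp (unitS sf sm (fun κ u => cE • e3OfK Lc (coDressKBmAt (toSite r) Lc (KInvStep (d := d) Lc j))
              (SrecAt d Lc (toSite r) ((Lc : ℝ) ^ (d + 1)) (-((Lc : ℝ) ^ (d + 1) * (1 / 2) * (Lc : ℝ) ^ (d + 1))) cΛ j) κ u) μ (toSite rr))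
            (unitK sf sm (coDressKBmAt (toSite r) Lc (KInvStep (d := d) Lc (j + 1)))))
            (unitS sf sm (fun κ u => cE • e3OfK Lc (coDressKBmAt (toSite r) Lc (KInvStep (d := d) Lc j))
              (SrecAt d Lc (toSite r) ((Lc : ℝ) ^ (d + 1)) (-((Lc : ℝ) ^ (d + 1) * (1 / 2) * (Lc : ℝ) ^ (d + 1))) cΛ j) κ u) ν t)
            yw.1 yw.2 (Sum.inl α) (Sum.inl β) =
      (((sf * sm)⁻¹ * (sf⁻¹ * sf⁻¹) * cE) * ((sf * sm)⁻¹ * (sf⁻¹ * sf⁻¹) * cE)) *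
      ((-(1 / 2 : ℝ)) * (1 / 2 : ℝ) * ((sf * sf) *
        ((wVH d Lc (j + 1))⁻¹ *
            ∑ x ∈ box (d + 1) (Lc * N), ∑ b : Fin (d + 1),
              ((if b = μ then ((((Lc * N : ℕ) : ℝ))⁻¹ * (((Lc * N : ℕ) : ℝ))⁻¹) * ((((toSite x α % ((Lc * N : ℕ) : ℤ) : ℤ) : ℝ) - ((((Lc * N : ℕ) : ℝ)) - 1) / 2)) else 0)
                + (if b = α then (-(((Lc * N : ℕ) : ℝ))⁻¹ * ((((toSite x μ % ((Lc * N : ℕ) : ℤ) : ℤ) : ℝ) - ((((Lc * N : ℕ) : ℝ)) - 1) / 2))) *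
                    (if toSite x α % ((Lc * N : ℕ) : ℤ) = ((Lc * N : ℕ) : ℤ) - 1 then (1 : ℝ) else 0) else 0)) *
              ∑' s : Site (d + 1), ∑ b' : Fin (d + 1), E2 d Lc (j + 1) (toSite x) s (Sum.inl b) (Sum.inl b') *
                ((if b' = ν then ((((Lc * N : ℕ) : ℝ))⁻¹ * (((Lc * N : ℕ) : ℝ))⁻¹) * ((((s β % ((Lc * N : ℕ) : ℤ) : ℤ) : ℝ) - ((((Lc * N : ℕ) : ℝ)) - 1) / 2)) else 0)
                  + (if b' = β then (-(((Lc * N : ℕ) : ℝ))⁻¹ * ((((s ν % ((Lc * N : ℕ) : ℤ) : ℤ) : ℝ) - ((((Lc * N : ℕ) : ℝ)) - 1) / 2))) *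
                      (if s β % ((Lc * N : ℕ) : ℤ) = ((Lc * N : ℕ) : ℤ) - 1 then (1 : ℝ) else 0) else 0)) -
          (wVH d Lc (j + 1))⁻¹ * (((Lc : ℝ) ^ (d + 1) * (Lc : ℝ) ^ (d + 1)) *
            ∑ y ∈ box (d + 1) N, ∑ a : Fin (d + 1),
              ((if a = μ then (((N : ℝ))⁻¹ * ((N : ℝ))⁻¹) * ((((toSite y α % (N : ℤ)) : ℤ) : ℝ) - ((N : ℝ) - 1) / 2) else 0)
                + (if a = α then (-((N : ℝ))⁻¹ * ((((toSite y μ % (N : ℤ)) : ℤ) : ℝ) - ((N : ℝ) - 1) / 2)) *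
                    (if toSite y α % (N : ℤ) = (N : ℤ) - 1 then (1 : ℝ) else 0) else 0)) *
              ∑' s : Site (d + 1), ∑ b' : Fin (d + 1), E2 d Lc (j + 2) (toSite y) s (Sum.inl a) (Sum.inl b') *
                ((if b' = ν then (((N : ℝ))⁻¹ * ((N : ℝ))⁻¹) * ((((s β % (N : ℤ)) : ℤ) : ℝ) - ((N : ℝ) - 1) / 2) else 0)
                  + (if b' = β then (-((N : ℝ))⁻¹ * ((((s ν % (N : ℤ)) : ℤ) : ℝ) - ((N : ℝ) - 1) / 2)) *
                      (if s β % (N : ℤ) = (N : ℤ) - 1 then (1 : ℝ) else 0) else 0)))))) := by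
  haveI : NeZero (Lc * N) := ⟨Nat.mul_ne_zero (NeZero.ne Lc) (NeZero.ne N)⟩
  obtain ⟨Cs, CX, m, hm, hS, hX⟩ := exists_common_rate (d := d) hr sf sm cE cΛ j
  rw [faceWord_eq_cellPairing (N := Lc * N) hS hX hm
      (fun κ t s => sectorE_translate (r := r) sf sm cE cΛ j κ t (((Lc * N : ℕ) : ℤ) • s))
      (fun s => dressedStep_invariant_deep (r := r) sf sm j N s)
      (fun κ t y x m b => sectorE_inr_left (r := r) sf sm cE cΛ j κ t y x m b)
      (fun κ t y x a m => sectorE_inr_right (r := r) sf sm cE cΛ j κ t y x a m) μ ν α β]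
  exact cellPairing_deep_value_units hr sf sm cE cΛ j N hμα hνβ

end Summit.QuantumFields.BalabanUV.Beta.GAN24.FaceWordEEDeep

end
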